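import Literature.Algebra.Lie.LefschetzTriple
import HarnessLib

/-!
# For a Jordan–Lefschetz pair, `[𝔤_2, 𝔤_{-2}]` spans `𝔤_0` (Looijenga–Lunts 1997, proof of (3.6))

Topic `Literature/Algebra/Lie` (namespace `Literature.Algebra.Lie`).  Lane `lit-hodgefound` (Track 2 foundations library),
skeleton seat `lit-hodgefound-skel-1` (generation 51), row **A1-197** of `run/shared/lean/pub/lit-hodgefound/SKELETON.md`;
an ABSTRACT complement to row A1-84 (`LefschetzTriple.lean`: `IsJordanLefschetzPair`, (2.2) `sup_adDegree_eq_top`,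
`adDegree_eq_bot`) used in passing by Looijenga–Lunts and proved case by case in rows A1-190/191/192
(`span_lie_eq_adDegree_zero_sp/_sl/_typeD`).  THEOREMS ONLY (no definition, no named fact, no `sorry`; net debt `0`).

## Source, VERBATIM

E. Looijenga, V. A. Lunts, *A Lie algebra attached to a projective variety*, Invent. Math. **129** (1997) 361–412 (held
TeX `paper:arxiv-alg-geom_9604014`), §3, proof of (3.6), p0014 L78–L80: "For a Jordan pair `(𝔤, h)`, `[𝔤_2, 𝔤_{-2}]`
generates `𝔤_0` and so it remains to show that `[𝔤_2, 𝔤_{-2}] ⊂ 𝔤_{NS}(X)`."; §1 p0007 L54–L78 ("(ii) `𝔤` is as a Lie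
algebra generated by `𝔞` and the image of `f`"); §2 (2.2) p0009 L112–L119 ("`𝔤 = 𝔤_{-2} ⊕ 𝔤_0 ⊕ 𝔤_2`").

## The argument (all proved)

Let `W = span [𝔤_2, 𝔤_{-2}] ⊆ 𝔤_0`.  By the Jacobi identity `[𝔤_0, W] ⊆ W` (`lie_mem_spanLie_of_mem_adDegree_zero`), so
`V = 𝔤_{-2} + W + 𝔤_2` is closed under the bracket (`[𝔤_{±2}, 𝔤_{±2}] = 0`, `[𝔤_{±2}, W] ⊆ 𝔤_{±2}`,
`[𝔤_2, 𝔤_{-2}] ⊆ W`, `[W, W] ⊆ [𝔤_0, W] ⊆ W`); `V` contains `𝔤_2` and the image of `f` (`⊆ 𝔤_{-2}`), which generate `𝔤`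
(clause (ii)), so `V = 𝔤`, and comparing degree-`0` parts in `𝔤 = 𝔤_{-2} ⊕ 𝔤_0 ⊕ 𝔤_2` gives `𝔤_0 = W`
(**`IsJordanLefschetzPair.span_lie_eq_adDegree_zero`**).  In words: `[𝔤_2, 𝔤_{-2}]` does not merely generate but SPANS
`𝔤_0`.
-/

namespace Literature.Algebra.Lie

variable {K : Type*} {L : Type*} [Field K] [LieRing L] [LieAlgebra K L] {h : L}

/-- `[𝔤_2, 𝔤_{-2}] ⊆ 𝔤_0`, hence its span. [cite: LooijengaLunts1997, §2 (2.2) p. 9 L112–L119] -/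
theorem span_lie_le_adDegree_zero (h : L) :
    Submodule.span K {z : L | ∃ x ∈ adDegree K h 2, ∃ y ∈ adDegree K h (-2), z = ⁅x, y⁆} ≤ adDegree K h 0 := by
  rw [Submodule.span_le]
  rintro _ ⟨x, hx, y, hy, rfl⟩
  have h0 := lie_mem_adDegree hx hy
  rwa [add_neg_cancel] at h0

/-- **`[𝔤_0, [𝔤_2, 𝔤_{-2}]] ⊆ span [𝔤_2, 𝔤_{-2}]`** (Jacobi: `[w, [x, y]] = [[w, x], y] + [x, [w, y]]` with `[w, x] ∈ 𝔤_2`,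
`[w, y] ∈ 𝔤_{-2}`). [cite: LooijengaLunts1997, §3 proof of (3.6) p. 14 L78–L80] -/
theorem lie_mem_spanLie_of_mem_adDegree_zero {w z : L} (hw : w ∈ adDegree K h 0)
    (hz : z ∈ Submodule.span K {z : L | ∃ x ∈ adDegree K h 2, ∃ y ∈ adDegree K h (-2), z = ⁅x, y⁆}) :
    ⁅w, z⁆ ∈ Submodule.span K {z : L | ∃ x ∈ adDegree K h 2, ∃ y ∈ adDegree K h (-2), z = ⁅x, y⁆} := by
  induction hz using Submodule.span_induction with
  | mem z hz =>
    obtain ⟨x, hx, y, hy, rfl⟩ := hz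
    rw [leibniz_lie]
    refine Submodule.add_mem _ (Submodule.subset_span ⟨⁅w, x⁆, ?_, y, hy, rfl⟩)
      (Submodule.subset_span ⟨x, hx, ⁅w, y⁆, ?_, rfl⟩)
    · have h1 := lie_mem_adDegree hw hx; rwa [zero_add] at h1
    · have h1 := lie_mem_adDegree hw hy; rwa [zero_add] at h1
  | zero => rw [lie_zero]; exact Submodule.zero_mem _
  | add a b _ _ ha hb => rw [lie_add]; exact Submodule.add_mem _ ha hb
  | smul c a _ ha => rw [lie_smul]; exact Submodule.smul_mem _ c ha

variable [CharZero K] [FiniteDimensional K L]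

/-- **For a Jordan–Lefschetz pair `(𝔤, h)`, `[𝔤_2, 𝔤_{-2}]` SPANS `𝔤_0`**: `span {[x, y] : x ∈ 𝔤_2, y ∈ 𝔤_{-2}} = 𝔤_0`
("For a Jordan pair `(𝔤, h)`, `[𝔤_2, 𝔤_{-2}]` generates `𝔤_0`").  Proof: `V = 𝔤_{-2} + span [𝔤_2, 𝔤_{-2}] + 𝔤_2` is a Lie
subalgebra containing `𝔤_2` and the image of `f`, hence all of `𝔤` by clause (ii) of a Lefschetz triple; compare degrees
in `𝔤 = 𝔤_{-2} ⊕ 𝔤_0 ⊕ 𝔤_2` ((2.2)). [cite: LooijengaLunts1997, §3 proof of (3.6) p. 14 L78–L80; §1 p. 7 L54–L78; §2 (2.2) p. 9 L112–L119] -/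
theorem IsJordanLefschetzPair.span_lie_eq_adDegree_zero (J : IsJordanLefschetzPair K h) :
    Submodule.span K {z : L | ∃ x ∈ adDegree K h 2, ∃ y ∈ adDegree K h (-2), z = ⁅x, y⁆} = adDegree K h 0 := by
  set W := Submodule.span K {z : L | ∃ x ∈ adDegree K h 2, ∃ y ∈ adDegree K h (-2), z = ⁅x, y⁆} with hW
  have hW0 : W ≤ adDegree K h 0 := span_lie_le_adDegree_zero h
  -- `V = 𝔤_{-2} + W + 𝔤_2`
  set V : Submodule K L := adDegree K h (-2) ⊔ W ⊔ adDegree K h 2 with hV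
  have memV₁ : ∀ z ∈ adDegree K h (-2), z ∈ V := fun z hz ↦ Submodule.mem_sup_left (Submodule.mem_sup_left hz)
  have memV₂ : ∀ z ∈ W, z ∈ V := fun z hz ↦ Submodule.mem_sup_left (Submodule.mem_sup_right hz)
  have memV₃ : ∀ z ∈ adDegree K h 2, z ∈ V := fun z hz ↦ Submodule.mem_sup_right hz
  -- `V` is closed under the bracket
  have hVlie : ∀ u ∈ V, ∀ u' ∈ V, ⁅u, u'⁆ ∈ V := by
    intro u hu u' hu'
    obtain ⟨uw, huw, c, hc, rfl⟩ := Submodule.mem_sup.1 hu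
    obtain ⟨a, ha, b, hb, rfl⟩ := Submodule.mem_sup.1 huw
    obtain ⟨uw', huw', c', hc', rfl⟩ := Submodule.mem_sup.1 hu'
    obtain ⟨a', ha', b', hb', rfl⟩ := Submodule.mem_sup.1 huw'
    simp only [add_lie, lie_add]
    refine V.add_mem (V.add_mem ?_ ?_) ?_ <;> refine V.add_mem (V.add_mem ?_ ?_) ?_
    · -- `[𝔤_{-2}, 𝔤_{-2}] = 0`
      rw [J.lie_eq_zero_of_mem_adDegree_neg_two ha ha']; exact V.zero_mem
    · -- `[W, 𝔤_{-2}] ⊆ 𝔤_{-2}`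
      refine memV₁ _ ?_
      have h1 := lie_mem_adDegree (hW0 hb) ha'; rwa [zero_add] at h1
    · -- `[𝔤_2, 𝔤_{-2}] ⊆ W`
      exact memV₂ _ (Submodule.subset_span ⟨c, hc, a', ha', rfl⟩)
    · -- `[𝔤_{-2}, W] ⊆ 𝔤_{-2}`
      refine memV₁ _ ?_
      have h1 := lie_mem_adDegree ha (hW0 hb'); rwa [add_zero] at h1
    · -- `[W, W] ⊆ W`
      exact memV₂ _ (lie_mem_spanLie_of_mem_adDegree_zero (hW0 hb) hb')
    · -- `[𝔤_2, W] ⊆ 𝔤_2`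
      refine memV₃ _ ?_
      have h1 := lie_mem_adDegree hc (hW0 hb'); rwa [add_zero] at h1
    · -- `[𝔤_{-2}, 𝔤_2] ⊆ W`
      refine memV₂ _ ?_
      rw [← lie_skew]
      exact W.neg_mem (Submodule.subset_span ⟨c', hc', a, ha, rfl⟩)
    · -- `[W, 𝔤_2] ⊆ 𝔤_2`
      refine memV₃ _ ?_
      have h1 := lie_mem_adDegree (hW0 hb) hc'; rwa [zero_add] at h1
    · -- `[𝔤_2, 𝔤_2] = 0`
      rw [J.lie_eq_zero_of_mem_adDegree_two hc hc']; exact V.zero_mem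
  -- so `V` is a Lie subalgebra containing the generators, hence everything
  let S : LieSubalgebra K L := { V with lie_mem' := fun {u u'} hu hu' ↦ hVlie u hu u' hu' }
  have hSV : ∀ {z : L}, z ∈ S ↔ z ∈ V := Iff.rfl
  have hS : S = ⊤ := by
    rw [eq_top_iff, ← J.lieSpan_eq_top, LieSubalgebra.lieSpan_le]
    rintro z (hz | hz)
    · exact hSV.2 (memV₃ z hz)
    · exact hSV.2 (memV₁ z (lefschetzDuals_subset_adDegree hz))
  -- compare degree-`0` parts
  refine le_antisymm hW0 fun z hz ↦ ?_
  have hzV : z ∈ V := hSV.1 (by rw [hS]; exact LieSubalgebra.mem_top z)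
  obtain ⟨uw, huw, c, hc, rfl⟩ := Submodule.mem_sup.1 hzV
  obtain ⟨a, ha, b, hb, rfl⟩ := Submodule.mem_sup.1 huw
  have hac : a + c ∈ adDegree K h 0 := by
    have h1 := Submodule.sub_mem _ hz (hW0 hb)
    rwa [show a + b + c - b = a + c by abel] at h1
  have hac' : a + c ∈ ⨆ b : Bool, adDegree K h (cond b (-2 : K) 2) :=
    Submodule.add_mem _ (Submodule.mem_iSup_of_mem true ha) (Submodule.mem_iSup_of_mem false hc)
  have hdisj := disjoint_adDegree_iSup h (d := fun b : Bool ↦ cond b (-2 : K) 2) (c := 0)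
    (by rintro (_ | _) <;> norm_num)
  have h0 : a + c = 0 := Submodule.disjoint_def.1 hdisj _ hac hac'
  rw [show a + b + c = b + (a + c) by abel, h0, add_zero]
  exact hb

/-- Hence every `z ∈ 𝔤_0` is a finite sum of brackets `[x_i, y_i]`, `x_i ∈ 𝔤_2`, `y_i ∈ 𝔤_{-2}` (the coefficients are
absorbed into the `x_i`). [cite: LooijengaLunts1997, §3 proof of (3.6) p. 14 L78–L80] -/
theorem IsJordanLefschetzPair.exists_sum_lie_eq (J : IsJordanLefschetzPair K h) {z : L} (hz : z ∈ adDegree K h 0) :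
    ∃ (n : ℕ) (x y : Fin n → L), (∀ i, x i ∈ adDegree K h 2) ∧ (∀ i, y i ∈ adDegree K h (-2)) ∧
      z = ∑ i, ⁅x i, y i⁆ := by
  rw [← J.span_lie_eq_adDegree_zero] at hz
  induction hz using Submodule.span_induction with
  | mem z hz =>
    obtain ⟨x, hx, y, hy, rfl⟩ := hz
    exact ⟨1, fun _ ↦ x, fun _ ↦ y, fun _ ↦ hx, fun _ ↦ hy, by simp⟩
  | zero => exact ⟨0, Fin.elim0, Fin.elim0, fun i ↦ i.elim0, fun i ↦ i.elim0, by simp⟩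
  | add a b _ _ ha hb =>
    obtain ⟨n, x, y, hx, hy, rfl⟩ := ha
    obtain ⟨n', x', y', hx', hy', rfl⟩ := hb
    refine ⟨n + n', Fin.append x x', Fin.append y y', fun i ↦ ?_, fun i ↦ ?_, ?_⟩
    · refine Fin.addCases (fun i ↦ ?_) (fun i ↦ ?_) i
      · rw [Fin.append_left]; exact hx i
      · rw [Fin.append_right]; exact hx' i
    · refine Fin.addCases (fun i ↦ ?_) (fun i ↦ ?_) i
      · rw [Fin.append_left]; exact hy i
      · rw [Fin.append_right]; exact hy' i
    · rw [Fin.sum_univ_add]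
      simp only [Fin.append_left, Fin.append_right]
  | smul c a _ ha =>
    obtain ⟨n, x, y, hx, hy, rfl⟩ := ha
    refine ⟨n, fun i ↦ c • x i, y, fun i ↦ Submodule.smul_mem _ c (hx i), hy, ?_⟩
    rw [Finset.smul_sum]
    simp only [smul_lie]

end Literature.Algebra.Lie
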